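/-
Copyright (c) 2026. All rights reserved.
Released under Apache 2.0 license as described in the file LICENSE.
Authors: abc-iut cell, seat abc-iut-L4-t14 (gen 5; proof-only, row «EA-ALL-BASES»: [AbsTopIII] Prop 4.2 (i)
«EA is id-rigid» in print's ∀X shape — for every cover-closed class of bases each uniformised by a
free-or-surface Fuchsian group with finite automorphism groups of its finite covers).
-/
import Literature.AnabelianGeometry.AbsoluteAnabelian.ArchimedeanHolFieldFunctorGeometricRCPSLHfinFree
import Literature.AnabelianGeometry.AbsoluteAnabelian.ArchimedeanHolFieldFunctorGeometricPSLUniformisedBaseFree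
import HarnessLib

/-!
# [AbsTopIII] Prop 4.2 (i) «`EA` is id-rigid» over ALL bases of a uniformised class

S. Mochizuki, *Topics in absolute anabelian geometry III*, proof of Prop 4.2 (i) p. 106 l. 11–19 (kurims
`paper:url-5493eb38cbb7`; bib key `MochizukiAbsTopIII2015`): «To verify the id-rigidity of `EA`, it suffices
to observe that for ANY object `X ∈ Ob(EA)` …, the full subcategory of `EA` consisting of objects that map
to `X` may … be identified with … `Loc_R(X)` …. Thus, the id-rigidity of `EA` follows immediately from the
slimness assertion of Lemma 4.3.»

PROOF-ONLY assembly (no definition, no named fact) of abc-iut-L4-t14's `hfin`-free columns into print's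
`∀ X` shape.  For a class `Q` of connected Riemann surfaces closed under finite étale covers
(abc-iut-L4-t14's `HolRS.IsCoverClosed`) such that EVERY `X ∈ Q` is uniformised — `X ≅ ℍ/Γ̄_X` in `HolRS`
for some `Γ̄_X ≤ PSL₂(ℝ)` free of finite rank or an orientable surface group, non-abelian, acting freely and
properly discontinuously — with `[N(Λ̄) : Λ̄] < ∞` for every finite-index `Λ̄ ≤ Γ̄_X` (finite automorphism
groups of the finite covers; discharged in the tree for compact `ℍ/Γ̄_X`, for arithmetic `Γ̄_X`, and from
cusp data (P)+(FC)):

* ★★ `HolRS.isIdRigid_EA_of_forall_uniformised` — **the geometric `EA(Q)` is ID-RIGID** (holomorphic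
  morphisms), and `HolRS.cor_4_5_geometric_of_forall_uniformised` — Cor 4.5 (i)–(v) for its archimedean
  log-Frobenius data (given one object);
* ★★ `HolRS.RC.isIdRigid_EA_of_forall_uniformised`, `HolRS.RC.cor_4_5_geometric_of_forall_uniformised` —
  the same for print-faithful RC morphisms (`Q` a cover-closed class in `RC`, `X ≅ toRC (ℍ/Γ̄_X)`).

So the ENTIRE residual of print's Prop 4.2 (i) id-rigidity at the geometric model is, per base `X`:
UNIFORMISATION by such a `Γ̄_X` + FINITENESS of `Aut` of the finite covers — no `hfin`, no arithmeticity.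
HONEST SCOPE: MODEL side of [AbsTopIII] §4 (model ≠ reconstruction: print's `EA → (profinite groups)`
functor and the passage to orbicurves are not the object here); uniformisation of an arbitrary hyperbolic
Riemann surface of finite type is NOT proved here (in the tree: `ℂ ∖ F`, `E ∖ {x₀}`, the tripod
`= ℍ/Γ̄(2)`).  Classical; nothing here bears on [IUTchIII] Cor. 3.12.
-/

set_option autoImplicit false

noncomputable section

open scoped UpperHalfPlane MatrixGroups
open _root_.MulAction _root_.CategoryTheory
open Literature.IUT.HodgeTheaters (IsFreeOrSurface)

namespace Literature.AnabelianGeometry.AbsoluteAnabelian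

namespace HolRS

/-! ### Holomorphic morphisms -/

/-- ★★ **[AbsTopIII] Prop 4.2 (i) in print's `∀ X` shape: the geometric `EA(Q)` is ID-RIGID** for every
class `Q ⊆ HolRS` closed under finite étale covers each of whose members `X` is `≅ ℍ/Γ̄_X` for a
free-or-surface, non-abelian `Γ̄_X ≤ PSL₂(ℝ)` acting freely and properly discontinuously with finite
`[N(Λ̄) : Λ̄]` for all finite-index `Λ̄ ≤ Γ̄_X` («objects mapping to `X`» id-rigid for every `X` by the
`hfin`-free column, then the local criterion `isIdRigid_EA_of_forall_isIdRigid_mapsTo`).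
[cite: MochizukiAbsTopIII2015, Proposition 4.2 (i) proof p.106] -/
theorem isIdRigid_EA_of_forall_uniformised (Q : ObjectProperty HolRS) (hQ : IsCoverClosed Q)
    (hU : ∀ X : HolRS, Q X → ∃ (Γ : Subgroup PSL2R) (_ : ProperlyDiscontinuousSMul Γ ℍ)
      (_ : IsCancelSMul Γ ℍ), IsFreeOrSurface Γ ∧ (∃ a b : Γ, a * b ≠ b * a) ∧
      (∀ Λ : _root_.Literature.AnabelianGeometry.AbsoluteAnabelian.LocObj Γ,
        (Λ.toSubgroup.subgroupOf (Subgroup.normalizer (Λ.toSubgroup : Set PSL2R))).FiniteIndex) ∧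
      Nonempty (pslQuotient Γ ≅ X)) :
    Literature.AnabelianGeometry.AbsoluteAnabelian.IsIdRigid (HolRS.geometricAutHolFieldFunctor Q).EA := by
  refine isIdRigid_EA_of_forall_isIdRigid_mapsTo Q fun X => ?_
  change IsIdRigid (ObjectProperty.FullSubcategory fun Y : Q.FullSubcategory => Nonempty (Y ⟶ X))
  rw [isIdRigid_mapsTo_fullSubcategory_iff Q hQ X]
  obtain ⟨Γ, iPD, iC, hΓ, hab, hN, ⟨e⟩⟩ := hU X.obj X.property
  rw [← nonempty_hom_eq_of_iso e]
  exact isIdRigid_EA_mapsTo_in_HolRS_of Γ hΓ hab hN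
where
  /-- the «objects of `HolRS` mapping to `ℍ/Γ̄`» step (abc-iut-L4-t14's `hfin`-free column at the top
  object). [cite: MochizukiAbsTopIII2015, Proposition 4.2 (i) proof p.106] -/
  isIdRigid_EA_mapsTo_in_HolRS_of (Γ : Subgroup PSL2R) [ProperlyDiscontinuousSMul Γ ℍ] [IsCancelSMul Γ ℍ]
      (hΓ : IsFreeOrSurface Γ) (hab : ∃ a b : Γ, a * b ≠ b * a)
      (hN : ∀ Λ : _root_.Literature.AnabelianGeometry.AbsoluteAnabelian.LocObj Γ,
        (Λ.toSubgroup.subgroupOf (Subgroup.normalizer (Λ.toSubgroup : Set PSL2R))).FiniteIndex) :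
      IsIdRigid (ObjectProperty.FullSubcategory fun Y : HolRS => Nonempty (Y ⟶ pslQuotient Γ)) := by
    haveI : (Γ.subgroupOf (Subgroup.normalizer (Γ : Set PSL2R))).FiniteIndex := hN (LocObj.top Γ)
    exact isIdRigid_mapsTo_pslQuotient_of_isFreeOrSurface_hfinFree Γ hΓ hab

/-- ★★ **[AbsTopIII] Cor 4.5 (i)–(v) for the archimedean log-Frobenius data over the geometric `EA(Q)`**
of such a uniformised cover-closed class `Q` (given one object `X₀`; abc-iut-L4-t10's `cor_4_5_geometric`).
[cite: MochizukiAbsTopIII2015, Corollary 4.5 pp.107–109] -/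
theorem cor_4_5_geometric_of_forall_uniformised (Q : ObjectProperty HolRS) (hQ : IsCoverClosed Q)
    (X₀ : (HolRS.geometricAutHolFieldFunctor Q).EA)
    (hU : ∀ X : HolRS, Q X → ∃ (Γ : Subgroup PSL2R) (_ : ProperlyDiscontinuousSMul Γ ℍ)
      (_ : IsCancelSMul Γ ℍ), IsFreeOrSurface Γ ∧ (∃ a b : Γ, a * b ≠ b * a) ∧
      (∀ Λ : _root_.Literature.AnabelianGeometry.AbsoluteAnabelian.LocObj Γ,
        (Λ.toSubgroup.subgroupOf (Subgroup.normalizer (Λ.toSubgroup : Set PSL2R))).FiniteIndex) ∧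
      Nonempty (pslQuotient Γ ≅ X)) :
    Literature.AnabelianGeometry.AbsoluteAnabelian.AbsTopIII.Cor_4_5
      (Literature.AnabelianGeometry.AbsoluteAnabelian.archLogFrobeniusData (HolRS.geometricAutHolFieldFunctor Q))
      (Literature.AnabelianGeometry.AbsoluteAnabelian.archTelecoreData (HolRS.geometricAutHolFieldFunctor Q)) :=
  cor_4_5_geometric Q X₀ (isIdRigid_EA_of_forall_uniformised Q hQ hU)

/-! ### Print-faithful (RC) morphisms -/

/-- ★★ **[AbsTopIII] Prop 4.2 (i) in print's `∀ X` shape, PRINT-FAITHFUL (RC) morphisms: the geometric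
`EA(Q)` of the RC instance is ID-RIGID** for every class `Q ⊆ RC` closed under RC finite étale covers each
of whose members is `≅ toRC (ℍ/Γ̄_X)` for a free-or-surface, non-abelian `Γ̄_X ≤ PSL₂(ℝ)` acting freely
and properly discontinuously with finite `[N_{PSL₂(ℝ)}(Λ̄) : Λ̄]` for all finite-index `Λ̄ ≤ Γ̄_X`.
[cite: MochizukiAbsTopIII2015, Proposition 4.2 (i) proof p.106] -/
theorem RC.isIdRigid_EA_of_forall_uniformised (Q : ObjectProperty RC)
    (hQ : ∀ {Y Z : RC}, (Y ⟶ Z) → Q Z → Q Y)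
    (hU : ∀ X : RC, Q X → ∃ (Γ : Subgroup PSL2R) (_ : ProperlyDiscontinuousSMul Γ ℍ)
      (_ : IsCancelSMul Γ ℍ), IsFreeOrSurface Γ ∧ (∃ a b : Γ, a * b ≠ b * a) ∧
      (∀ Λ : _root_.Literature.AnabelianGeometry.AbsoluteAnabelian.LocObj Γ,
        (Λ.toSubgroup.subgroupOf (Subgroup.normalizer (Λ.toSubgroup : Set PSL2R))).FiniteIndex) ∧
      Nonempty (toRC.obj (pslQuotient Γ) ≅ X)) :
    Literature.AnabelianGeometry.AbsoluteAnabelian.IsIdRigid (HolRS.geometricAutHolFieldFunctorRC Q).EA := by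
  refine isIdRigid_EA_RC_of_forall_isIdRigid_mapsTo Q fun X => ?_
  change IsIdRigid (ObjectProperty.FullSubcategory fun Y : Q.FullSubcategory => Nonempty (Y ⟶ X))
  rw [isIdRigid_mapsTo_fullSubcategory_iff Q hQ X]
  obtain ⟨Γ, iPD, iC, hΓ, hab, hN, ⟨e⟩⟩ := hU X.obj X.property
  rw [← nonempty_hom_eq_of_iso e]
  haveI : (Γ.subgroupOf (Subgroup.normalizer (Γ : Set PSL2R))).FiniteIndex := hN (LocObj.top Γ)
  exact RC.isIdRigid_mapsTo_pslQuotient_of_isFreeOrSurface_hfinFree Γ hΓ hab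

/-- ★★ **[AbsTopIII] Cor 4.5 (i)–(v), PRINT-FAITHFUL morphisms, over the geometric `EA(Q)`** of such a
uniformised cover-closed class `Q ⊆ RC` (given one object; abc-iut-L4-t10's `cor_4_5_geometricRC`).
[cite: MochizukiAbsTopIII2015, Corollary 4.5 pp.107–109] -/
theorem RC.cor_4_5_geometric_of_forall_uniformised (Q : ObjectProperty RC)
    (hQ : ∀ {Y Z : RC}, (Y ⟶ Z) → Q Z → Q Y)
    (X₀ : (HolRS.geometricAutHolFieldFunctorRC Q).EA)
    (hU : ∀ X : RC, Q X → ∃ (Γ : Subgroup PSL2R) (_ : ProperlyDiscontinuousSMul Γ ℍ)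
      (_ : IsCancelSMul Γ ℍ), IsFreeOrSurface Γ ∧ (∃ a b : Γ, a * b ≠ b * a) ∧
      (∀ Λ : _root_.Literature.AnabelianGeometry.AbsoluteAnabelian.LocObj Γ,
        (Λ.toSubgroup.subgroupOf (Subgroup.normalizer (Λ.toSubgroup : Set PSL2R))).FiniteIndex) ∧
      Nonempty (toRC.obj (pslQuotient Γ) ≅ X)) :
    Literature.AnabelianGeometry.AbsoluteAnabelian.AbsTopIII.Cor_4_5
      (Literature.AnabelianGeometry.AbsoluteAnabelian.archLogFrobeniusData
        (HolRS.geometricAutHolFieldFunctorRC Q))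
      (Literature.AnabelianGeometry.AbsoluteAnabelian.archTelecoreData
        (HolRS.geometricAutHolFieldFunctorRC Q)) :=
  cor_4_5_geometricRC Q X₀ (RC.isIdRigid_EA_of_forall_uniformised Q hQ hU)

end HolRS

end Literature.AnabelianGeometry.AbsoluteAnabelian

end
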